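/-
Copyright: the b2b-balaban T⁴-continuum CRUX team, row NE7b OWNER lineage `t4-ne7b-p1` (gen 122). Project licence.
-/
import Summits.QuantumFields.BalabanUV.T4Continuum.Spine.NE7b.SupTorusPerturbedLocality
import Summits.QuantumFields.BalabanUV.T4Continuum.Spine.NE7b.SupTorusCoarseFloor

/-!
# THE BLOCK COLUMNS AND THE SCHUR COMPLEMENT OF THE PERTURBED HESSIAN `H + K` (`K` an exponentially decaying kernel): the displayed action
# plus `Σ_z K(·,z)u z` is linear and (by (163)) injective, hence ONTO — the block columns `ψ^K_{y′} = (H + K)⁻¹𝟙_{B_{y′}}` EXIST; for a SYMMETRIC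
# kernel the form is symmetric, so the Schur complement `T_K(y,y′) = (n+1)^{−d}Σ_z ψ^K_{y′}(σ(chart (wm y) z))` is symmetric; and by (164)'s
# block locality `|T_K(y,y′)| ≤ (m_κ − εK_{γ−κ})⁻¹e^{2dκ}e^{−κρ_s(y,y′)}` — (133)∕(134)∕(148) RE-RUN for the class of Hessians the road's step
# produces (row NE7b, node U5c; (133)∕(134)∕(135)∕(148)∕(163)∕(164) BY NAME; [folklore])

Cell `pub-balaban`, sub-cell `t4`, spine estimate NE7b (`T4WeightBudget.RelWeightBound`; the cell's OWN estimate — NOT PRINTED in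
[Bałaban 1983–89], NOT PROVED).  Crux-route work under `Spine/NE7b/` by the row OWNER (`t4-ne7b-p1` gen 122, file (165)) under FREEZE
(0)'s crux-prover clause; NOTHING of Bałaban's is named as a Lean object, valued or asserted; no `T4Continuum/Support` leaf typed; no `def`,
no notation (the action and the kernel sum DISPLAYED; the linear map behind surjectivity is a LOCAL `let`); zero `sorry`.  Imports (BY
NAME): the OWNER's (164) `…SupTorusPerturbedLocality` (`perturbed_blockSq_le_of_block_source`; through it (163) `decaying_kernel_injective`,
(133) `action_form_symm`, `action_sub`, `sum_indicator_mul`), (135) `…SupTorusCoarseFloor` (`action_smul`), Mathlib's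
`LinearMap.injective_iff_surjective`, `sq_sum_le_card_mul_sum_sq`.

WHY (located).  (164) gave the block locality of `(H + K)⁻¹f` for a GIVEN solution; the column needs the block columns to EXIST and the
Schur complement to be symmetric and decaying, exactly as (133)∕(134)∕(148) did for `H`.  Existence is finite-dimensional linear algebra
(injective endomorphism ⟹ onto); symmetry needs `K(x,z) = K(z,x)` (the road's kernels are Hessians, hence symmetric); decay is block
Cauchy–Schwarz on (164) §2 with the source `𝟙_{B_{y′}}` (`Σ f² = (n+1)^d`, which the block mean divides out).

WHAT IS PROVED ([folklore]; fine torus `Site d ((n+1)s)`, coarse `Site d s`; `(H + K)u` DISPLAYED; `m_κ`, `K_α` as in (164)):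
* §1 `perturbed_action_sub`, `perturbed_action_smul` (linearity), **`perturbed_action_surjective`** (`a ≥ 0`, `V ≥ −λ`, `|K| ≤ εe^{−γρ}`, `γ > 0`,
  `εK_γ < min(2,a) − λ` ⟹ every `f` is `(H + K)u`), **`perturbed_exists_blockColumns`**.
* §2 **`perturbed_form_symm`** (`K` symmetric ⟹ `Σ_x ψ x·((H + K)φ)(x) = Σ_x φ x·((H + K)ψ)(x)`), `perturbed_schur_symm` (`T_K(y,y′) = T_K(y′,y)`).
* §3 **`perturbed_schur_entry_le`** (`0 ≤ κ ≤ 1`, `κ < γ`, `εK_{γ−κ} < m_κ` ⟹ `|T_K(y,y′)| ≤ (m_κ − εK_{γ−κ})⁻¹e^{2dκ}e^{−κρ_s(y,y′)}`).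
* §4 toy.

HONEST (what this is NOT).  The coarse floor (135) and hence the decay of `T_K⁻¹`, the next-scale operator, response, covariance, pointwise
and volume letters for `H + K` remain; cubic periods; scalar skeleton ((A3), NC-NE7b-α UNRULED); nothing of Bałaban's.  BY-NAME EFFECT ON THE
WALL: NONE.  NE7b NOT PRINTED ∕ NOT PROVED; spine PROVED 0∕9; rung (B)+1 on a FINITE torus — NOT infinite volume, NOT the mass gap, NOT Clay.
HONEST DEPENDENCY: continuum YM on T⁴ ⇐ BetaPertH ∧ nine spine estimates (0∕9 proved); BetaPertH ⇐ (D1) ∧ (D4) ∧ CAP+tail; G-an2-4 gates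
asym, D1 and NE2∕3∕4.
-/

set_option autoImplicit false

noncomputable section

namespace Summit.QuantumFields.BalabanUV.T4Continuum.NE7b.SupTorusPerturbedColumns

open Real
open Literature.MathematicalPhysics.QuantumFieldTheory.Balaban1983to89
open B6QGQLower276 (X e blk B side chart mem_B sum_B sum_B_const card_cube blk_chart)
open Beta (Site siteOf windowMap siteOf_windowMap siteOf_add)
open SupTorusBlockDistance (isPseudoDist_torus)
open SupTorusActionForm (action_form_symm action_sub sum_indicator_mul)
open SupTorusCoarseFloor (action_smul)
open SupTorusPerturbedKernelSums (decaying_kernel_injective)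
open SupTorusPerturbedLocality (perturbed_blockSq_le_of_block_source)

variable {d : ℕ}

/-! ## §1. Linearity, surjectivity, block columns -/

section Linear

variable (n : ℕ) (a : ℝ) (s : ℕ) [NeZero s] (V : Site d ((n + 1) * s) → ℝ) (K : Site d ((n + 1) * s) → Site d ((n + 1) * s) → ℝ)

/-- Linearity — differences: `(H + K)(u − u′) = (H + K)u − (H + K)u′` pointwise. [folklore] -/
theorem perturbed_action_sub (u u' : Site d ((n + 1) * s) → ℝ) (x : Site d ((n + 1) * s)) :
    ((n : ℝ) + 1) ^ 2 * ∑ μ, (2 * (u x - u' x) - (u (x + siteOf d ((n + 1) * s) (e μ)) - u' (x + siteOf d ((n + 1) * s) (e μ)))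
          - (u (x - siteOf d ((n + 1) * s) (e μ)) - u' (x - siteOf d ((n + 1) * s) (e μ))))
        + a / ((n : ℝ) + 1) ^ d * ∑ q ∈ B n (blk n (windowMap d ((n + 1) * s) x)), (u (siteOf d ((n + 1) * s) q) - u' (siteOf d ((n + 1) * s) q))
        + V x * (u x - u' x) + ∑ z, K x z * (u z - u' z)
      = (((n : ℝ) + 1) ^ 2 * ∑ μ, (2 * u x - u (x + siteOf d ((n + 1) * s) (e μ)) - u (x - siteOf d ((n + 1) * s) (e μ)))
          + a / ((n : ℝ) + 1) ^ d * ∑ q ∈ B n (blk n (windowMap d ((n + 1) * s) x)), u (siteOf d ((n + 1) * s) q) + V x * u x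
          + ∑ z, K x z * u z)
        - (((n : ℝ) + 1) ^ 2 * ∑ μ, (2 * u' x - u' (x + siteOf d ((n + 1) * s) (e μ)) - u' (x - siteOf d ((n + 1) * s) (e μ)))
          + a / ((n : ℝ) + 1) ^ d * ∑ q ∈ B n (blk n (windowMap d ((n + 1) * s) x)), u' (siteOf d ((n + 1) * s) q) + V x * u' x
          + ∑ z, K x z * u' z) := by
  rw [action_sub n a s V u u' x]
  simp only [mul_sub, Finset.sum_sub_distrib]
  ring

/-- Linearity — scalars: `(H + K)(c·u) = c·(H + K)u` pointwise. [folklore] -/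
theorem perturbed_action_smul (u : Site d ((n + 1) * s) → ℝ) (c : ℝ) (x : Site d ((n + 1) * s)) :
    ((n : ℝ) + 1) ^ 2 * ∑ μ, (2 * (c * u x) - c * u (x + siteOf d ((n + 1) * s) (e μ)) - c * u (x - siteOf d ((n + 1) * s) (e μ)))
        + a / ((n : ℝ) + 1) ^ d * ∑ q ∈ B n (blk n (windowMap d ((n + 1) * s) x)), c * u (siteOf d ((n + 1) * s) q) + V x * (c * u x)
        + ∑ z, K x z * (c * u z)
      = c * (((n : ℝ) + 1) ^ 2 * ∑ μ, (2 * u x - u (x + siteOf d ((n + 1) * s) (e μ)) - u (x - siteOf d ((n + 1) * s) (e μ)))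
          + a / ((n : ℝ) + 1) ^ d * ∑ q ∈ B n (blk n (windowMap d ((n + 1) * s) x)), u (siteOf d ((n + 1) * s) q) + V x * u x
          + ∑ z, K x z * u z) := by
  rw [action_smul n a s V u c x]
  have h : ∑ z, K x z * (c * u z) = c * ∑ z, K x z * u z := by
    rw [Finset.mul_sum]; exact Finset.sum_congr rfl fun z _ => by ring
  rw [h]; ring

/-- **THE PERTURBED ACTION IS SURJECTIVE**: for `a ≥ 0`, `V ≥ −λ`, `|K(x,z)| ≤ εe^{−γρ(x,z)}`, `γ > 0`, `ε ≥ 0`, `εK_γ < min(2,a) − λ`, every `f`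
is `(H + K)u` — an injective ((163) `decaying_kernel_injective`) linear endomorphism of a finite-dimensional space is onto. [folklore] -/
theorem perturbed_action_surjective (ha : 0 ≤ a) {lam ε γ : ℝ} (hε : 0 ≤ ε) (hγ : 0 < γ)
    (hm : ε * (2 * (1 - exp (-γ))⁻¹) ^ d < min 2 a - lam) (hV : ∀ x, -lam ≤ V x)
    (hK : ∀ x z, |K x z| ≤ ε * exp (-(γ * ∑ i, (((x i - z i).valMinAbs.natAbs : ℕ) : ℝ)))) (f : Site d ((n + 1) * s) → ℝ) :
    ∃ u : Site d ((n + 1) * s) → ℝ, ∀ x,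
      ((n : ℝ) + 1) ^ 2 * ∑ μ, (2 * u x - u (x + siteOf d ((n + 1) * s) (e μ)) - u (x - siteOf d ((n + 1) * s) (e μ)))
        + a / ((n : ℝ) + 1) ^ d * ∑ q ∈ B n (blk n (windowMap d ((n + 1) * s) x)), u (siteOf d ((n + 1) * s) q) + V x * u x
        + ∑ z, K x z * u z = f x := by
  classical
  let Hop : (Site d ((n + 1) * s) → ℝ) →ₗ[ℝ] (Site d ((n + 1) * s) → ℝ) :=
    { toFun := fun u x => ((n : ℝ) + 1) ^ 2 * ∑ μ, (2 * u x - u (x + siteOf d ((n + 1) * s) (e μ)) - u (x - siteOf d ((n + 1) * s) (e μ)))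
        + a / ((n : ℝ) + 1) ^ d * ∑ q ∈ B n (blk n (windowMap d ((n + 1) * s) x)), u (siteOf d ((n + 1) * s) q) + V x * u x
        + ∑ z, K x z * u z
      map_add' := fun u v => by
        funext x
        simp only [Pi.add_apply]
        have h := perturbed_action_sub n a s V K (fun x => u x + v x) v x
        simp only [add_sub_cancel_right] at h
        linarith
      map_smul' := fun c u => by
        funext x
        simp only [Pi.smul_apply, smul_eq_mul, RingHom.id_apply]
        exact perturbed_action_smul n a s V K u c x }
  have hinj : Function.Injective Hop := fun u v huv =>
    decaying_kernel_injective n a s ha hε hγ hm V hV K hK u v fun x => congrFun huv x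
  obtain ⟨u, hu⟩ := (LinearMap.injective_iff_surjective.1 hinj) f
  exact ⟨u, fun x => congrFun hu x⟩

/-- **THE BLOCK COLUMNS OF `(H + K)⁻¹` EXIST**: `ψ^K_{y′}` with `(H + K)ψ^K_{y′} = 𝟙[bt · = y′]` for every coarse `y′`. [folklore] -/
theorem perturbed_exists_blockColumns (ha : 0 ≤ a) {lam ε γ : ℝ} (hε : 0 ≤ ε) (hγ : 0 < γ)
    (hm : ε * (2 * (1 - exp (-γ))⁻¹) ^ d < min 2 a - lam) (hV : ∀ x, -lam ≤ V x)
    (hK : ∀ x z, |K x z| ≤ ε * exp (-(γ * ∑ i, (((x i - z i).valMinAbs.natAbs : ℕ) : ℝ)))) :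
    ∃ ψ : Site d s → Site d ((n + 1) * s) → ℝ, ∀ y' x,
      ((n : ℝ) + 1) ^ 2 * ∑ μ, (2 * ψ y' x - ψ y' (x + siteOf d ((n + 1) * s) (e μ)) - ψ y' (x - siteOf d ((n + 1) * s) (e μ)))
        + a / ((n : ℝ) + 1) ^ d * ∑ q ∈ B n (blk n (windowMap d ((n + 1) * s) x)), ψ y' (siteOf d ((n + 1) * s) q) + V x * ψ y' x
        + ∑ z, K x z * ψ y' z = if siteOf d s (blk n (windowMap d ((n + 1) * s) x)) = y' then 1 else 0 := by
  classical
  choose ψ hψ using fun y' : Site d s => perturbed_action_surjective n a s V K ha hε hγ hm hV hK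
    fun x => if siteOf d s (blk n (windowMap d ((n + 1) * s) x)) = y' then (1 : ℝ) else 0
  exact ⟨ψ, hψ⟩

end Linear

/-! ## §2. Symmetry -/

section Symm

variable (n : ℕ) (a : ℝ) (s : ℕ) [NeZero s] (V : Site d ((n + 1) * s) → ℝ) (K : Site d ((n + 1) * s) → Site d ((n + 1) * s) → ℝ)
  (hKs : ∀ x z, K x z = K z x)

include hKs in
/-- **THE PERTURBED FORM IS SYMMETRIC** for a symmetric kernel: `Σ_x ψ x·((H + K)φ)(x) = Σ_x φ x·((H + K)ψ)(x)` ((133) `action_form_symm` +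
`Σ_xΣ_z ψ x K x z φ z = Σ_xΣ_z φ x K x z ψ z`). [folklore] -/
theorem perturbed_form_symm (φ ψ : Site d ((n + 1) * s) → ℝ) :
    ∑ x, ψ x * (((n : ℝ) + 1) ^ 2 * ∑ μ, (2 * φ x - φ (x + siteOf d ((n + 1) * s) (e μ)) - φ (x - siteOf d ((n + 1) * s) (e μ)))
        + a / ((n : ℝ) + 1) ^ d * ∑ q ∈ B n (blk n (windowMap d ((n + 1) * s) x)), φ (siteOf d ((n + 1) * s) q) + V x * φ x
        + ∑ z, K x z * φ z)
      = ∑ x, φ x * (((n : ℝ) + 1) ^ 2 * ∑ μ, (2 * ψ x - ψ (x + siteOf d ((n + 1) * s) (e μ)) - ψ (x - siteOf d ((n + 1) * s) (e μ)))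
        + a / ((n : ℝ) + 1) ^ d * ∑ q ∈ B n (blk n (windowMap d ((n + 1) * s) x)), ψ (siteOf d ((n + 1) * s) q) + V x * ψ x
        + ∑ z, K x z * ψ z) := by
  have hH := action_form_symm n a s V φ ψ
  have hKsum : ∑ x, ψ x * ∑ z, K x z * φ z = ∑ x, φ x * ∑ z, K x z * ψ z := by
    calc ∑ x, ψ x * ∑ z, K x z * φ z = ∑ x, ∑ z, ψ x * (K x z * φ z) := Finset.sum_congr rfl fun x _ => Finset.mul_sum _ _ _
      _ = ∑ z, ∑ x, ψ x * (K x z * φ z) := Finset.sum_comm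
      _ = ∑ z, φ z * ∑ x, K z x * ψ x := by
          refine Finset.sum_congr rfl fun z _ => ?_
          rw [Finset.mul_sum]
          exact Finset.sum_congr rfl fun x _ => by rw [hKs x z]; ring
  have e1 : ∀ (α β : Site d ((n + 1) * s) → ℝ) (x : Site d ((n + 1) * s)),
      α x * (((n : ℝ) + 1) ^ 2 * ∑ μ, (2 * β x - β (x + siteOf d ((n + 1) * s) (e μ)) - β (x - siteOf d ((n + 1) * s) (e μ)))
        + a / ((n : ℝ) + 1) ^ d * ∑ q ∈ B n (blk n (windowMap d ((n + 1) * s) x)), β (siteOf d ((n + 1) * s) q) + V x * β x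
        + ∑ z, K x z * β z)
      = α x * (((n : ℝ) + 1) ^ 2 * ∑ μ, (2 * β x - β (x + siteOf d ((n + 1) * s) (e μ)) - β (x - siteOf d ((n + 1) * s) (e μ)))
        + a / ((n : ℝ) + 1) ^ d * ∑ q ∈ B n (blk n (windowMap d ((n + 1) * s) x)), β (siteOf d ((n + 1) * s) q) + V x * β x)
        + α x * ∑ z, K x z * β z := fun α β x => by ring
  simp only [e1, Finset.sum_add_distrib]
  rw [hH, hKsum]

end Symm

/-! ## §3. The Schur complement of `H + K`: symmetric, exponentially decaying entries -/

section Schur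

variable (n : ℕ) (a : ℝ) (s : ℕ) [NeZero s] (ha : 0 ≤ a) {lam κ ε γ : ℝ} (hκ0 : 0 ≤ κ) (hκ1 : κ ≤ 1) (hκγ : κ < γ) (hε : 0 ≤ ε)
  (hm : ε * (2 * (1 - exp (-(γ - κ)))⁻¹) ^ d < min 2 a - lam - 2 * d * κ ^ 2 - a * (exp (2 * d * κ) - 1))
  (V : Site d ((n + 1) * s) → ℝ) (hV : ∀ x, -lam ≤ V x)
  (K : Site d ((n + 1) * s) → Site d ((n + 1) * s) → ℝ)
  (hK : ∀ x z, |K x z| ≤ ε * exp (-(γ * ∑ i, (((x i - z i).valMinAbs.natAbs : ℕ) : ℝ))))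
  (ψ : Site d s → Site d ((n + 1) * s) → ℝ)
  (hψ : ∀ y' x, ((n : ℝ) + 1) ^ 2 * ∑ μ, (2 * ψ y' x - ψ y' (x + siteOf d ((n + 1) * s) (e μ)) - ψ y' (x - siteOf d ((n + 1) * s) (e μ)))
      + a / ((n : ℝ) + 1) ^ d * ∑ q ∈ B n (blk n (windowMap d ((n + 1) * s) x)), ψ y' (siteOf d ((n + 1) * s) q) + V x * ψ y' x
      + ∑ z, K x z * ψ y' z = if siteOf d s (blk n (windowMap d ((n + 1) * s) x)) = y' then 1 else 0)

include hψ in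
/-- **THE PERTURBED SCHUR COMPLEMENT IS SYMMETRIC** for a symmetric kernel: `T_K(y,y′) = T_K(y′,y)`. [folklore] -/
theorem perturbed_schur_symm (hKs : ∀ x z, K x z = K z x) (y y' : Site d s) :
    (((n : ℝ) + 1) ^ d)⁻¹ * ∑ z : Fin d → Fin (n + 1), ψ y' (siteOf d ((n + 1) * s) (chart n (windowMap d s y) z))
      = (((n : ℝ) + 1) ^ d)⁻¹ * ∑ z : Fin d → Fin (n + 1), ψ y (siteOf d ((n + 1) * s) (chart n (windowMap d s y') z)) := by
  congr 1
  rw [← sum_indicator_mul n s y (ψ y'), ← sum_indicator_mul n s y' (ψ y)]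
  have h := perturbed_form_symm n a s V K hKs (ψ y) (ψ y')
  simp only [hψ] at h
  rw [show ∑ x, (if siteOf d s (blk n (windowMap d ((n + 1) * s) x)) = y then (1 : ℝ) else 0) * ψ y' x
      = ∑ x, ψ y' x * (if siteOf d s (blk n (windowMap d ((n + 1) * s) x)) = y then (1 : ℝ) else 0) from
      Finset.sum_congr rfl fun x _ => mul_comm _ _,
    show ∑ x, (if siteOf d s (blk n (windowMap d ((n + 1) * s) x)) = y' then (1 : ℝ) else 0) * ψ y x
      = ∑ x, ψ y x * (if siteOf d s (blk n (windowMap d ((n + 1) * s) x)) = y' then (1 : ℝ) else 0) from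
      Finset.sum_congr rfl fun x _ => mul_comm _ _]
  exact h

include ha hκ0 hκ1 hκγ hε hm hV hK hψ in
/-- **THE ENTRIES OF THE PERTURBED SCHUR COMPLEMENT DECAY**: `|T_K(y,y′)| ≤ (m_κ − εK_{γ−κ})⁻¹e^{2dκ}e^{−κρ_s(y,y′)}` — block Cauchy–Schwarz on
(164) `perturbed_blockSq_le_of_block_source` with the source `𝟙_{B_{y′}}` (`Σ f² = (n+1)^d`). [folklore] -/
theorem perturbed_schur_entry_le (y y' : Site d s) :
    |(((n : ℝ) + 1) ^ d)⁻¹ * ∑ z : Fin d → Fin (n + 1), ψ y' (siteOf d ((n + 1) * s) (chart n (windowMap d s y) z))|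
      ≤ (min 2 a - lam - 2 * d * κ ^ 2 - a * (exp (2 * d * κ) - 1) - ε * (2 * (1 - exp (-(γ - κ)))⁻¹) ^ d)⁻¹ * exp (2 * d * κ)
        * exp (-(κ * ∑ i, (((y i - y' i).valMinAbs.natAbs : ℕ) : ℝ))) := by
  classical
  set m := min 2 a - lam - 2 * d * κ ^ 2 - a * (exp (2 * d * κ) - 1) - ε * (2 * (1 - exp (-(γ - κ)))⁻¹) ^ d with hm_def
  have hm0 : 0 < m := by rw [hm_def]; linarith
  have hvol : (0 : ℝ) < ((n : ℝ) + 1) ^ d := by positivity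
  -- the source `𝟙[bt · = y′]`: supported in the block `y′`, `Σ f² = (n+1)^d`
  have hsupp : ∀ x, siteOf d s (blk n (windowMap d ((n + 1) * s) x)) ≠ y' →
      (if siteOf d s (blk n (windowMap d ((n + 1) * s) x)) = y' then (1 : ℝ) else 0) = 0 := fun x hx => if_neg hx
  have hf2 : ∑ x, (if siteOf d s (blk n (windowMap d ((n + 1) * s) x)) = y' then (1 : ℝ) else 0) ^ 2 = ((n : ℝ) + 1) ^ d := by
    have e1 : ∀ x, (if siteOf d s (blk n (windowMap d ((n + 1) * s) x)) = y' then (1 : ℝ) else 0) ^ 2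
        = (if siteOf d s (blk n (windowMap d ((n + 1) * s) x)) = y' then (1 : ℝ) else 0) * 1 := fun x => by
      split_ifs <;> simp
    rw [Finset.sum_congr rfl fun x _ => e1 x, sum_indicator_mul n s y' (fun _ => (1 : ℝ)), Finset.sum_const, Finset.card_univ,
      nsmul_eq_mul, mul_one, card_cube]
  have hblock := perturbed_blockSq_le_of_block_source n a s ha hκ0 hκ1 hκγ hε hm V hV K hK (ψ y')
    (fun x => if siteOf d s (blk n (windowMap d ((n + 1) * s) x)) = y' then (1 : ℝ) else 0) (hψ y') y' hsupp y
  rw [hf2] at hblock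
  have hCS := sq_sum_le_card_mul_sum_sq (s := (Finset.univ : Finset (Fin d → Fin (n + 1))))
    (f := fun z => ψ y' (siteOf d ((n + 1) * s) (chart n (windowMap d s y) z)))
  rw [Finset.card_univ, card_cube] at hCS
  have h4 : exp (4 * d * κ) = exp (2 * d * κ) ^ 2 := by rw [sq, ← exp_add]; ring_nf
  have h5 : exp (-(2 * κ * ∑ i, (((y i - y' i).valMinAbs.natAbs : ℕ) : ℝ)))
      = exp (-(κ * ∑ i, (((y i - y' i).valMinAbs.natAbs : ℕ) : ℝ))) ^ 2 := by rw [sq, ← exp_add]; ring_nf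
  have hR : 0 ≤ m⁻¹ * exp (2 * d * κ) * exp (-(κ * ∑ i, (((y i - y' i).valMinAbs.natAbs : ℕ) : ℝ))) := by
    have : 0 ≤ m⁻¹ := inv_nonneg.2 hm0.le
    positivity
  have hsq : ((((n : ℝ) + 1) ^ d)⁻¹ * ∑ z : Fin d → Fin (n + 1), ψ y' (siteOf d ((n + 1) * s) (chart n (windowMap d s y) z))) ^ 2
      ≤ (m⁻¹ * exp (2 * d * κ) * exp (-(κ * ∑ i, (((y i - y' i).valMinAbs.natAbs : ℕ) : ℝ)))) ^ 2 := by
    calc ((((n : ℝ) + 1) ^ d)⁻¹ * ∑ z : Fin d → Fin (n + 1), ψ y' (siteOf d ((n + 1) * s) (chart n (windowMap d s y) z))) ^ 2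
        = (((n : ℝ) + 1) ^ d)⁻¹ ^ 2 * (∑ z : Fin d → Fin (n + 1), ψ y' (siteOf d ((n + 1) * s) (chart n (windowMap d s y) z))) ^ 2 := by
          rw [mul_pow]
      _ ≤ (((n : ℝ) + 1) ^ d)⁻¹ ^ 2 * (((n : ℝ) + 1) ^ d
          * ∑ z : Fin d → Fin (n + 1), ψ y' (siteOf d ((n + 1) * s) (chart n (windowMap d s y) z)) ^ 2) :=
          mul_le_mul_of_nonneg_left hCS (sq_nonneg _)
      _ ≤ (((n : ℝ) + 1) ^ d)⁻¹ ^ 2 * (((n : ℝ) + 1) ^ d * ((m⁻¹) ^ 2 * exp (4 * d * κ)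
          * exp (-(2 * κ * ∑ i, (((y i - y' i).valMinAbs.natAbs : ℕ) : ℝ))) * ((n : ℝ) + 1) ^ d)) :=
          mul_le_mul_of_nonneg_left (mul_le_mul_of_nonneg_left hblock hvol.le) (sq_nonneg _)
      _ = _ := by rw [h4, h5]; field_simp
  exact abs_le_of_sq_le_sq' hsq hR |>.2 |> fun h => abs_le.2 ⟨(abs_le_of_sq_le_sq' hsq hR).1, h⟩

end Schur

/-! ## §4. Toy -/

/-- Toy (`d = 0`, `a = 1`, `λ = 0`, `γ = 1`, `ε = 0`): the surjectivity hypothesis `εK_γ < min(2,a) − λ` is inhabited. -/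
example : (0 : ℝ) * (2 * (1 - exp (-(1 : ℝ)))⁻¹) ^ (0 : ℕ) < min 2 (1 : ℝ) - 0 := by norm_num

end Summit.QuantumFields.BalabanUV.T4Continuum.NE7b.SupTorusPerturbedColumns
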